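import Literature.NumberTheory.Rogawski1990.LocalTransferCentralSingularJunctionCM    -- ★ p841395 F0P2-p02 (g8): the box junction; its ε-side bookkeeping `finsum_mem_side_eq_mul_stableOrbitalIntegralRel` is REUSED verbatim
import HarnessLib

/-!
# THE CENTRAL SINGULAR JUNCTION, INVARIANT FORM — `R_φ` is a local stable orbital integral at `ε_H = (a·1₂, u)` from an `Ad(Z(ε))`-INVARIANT descent datum:
# no saturation hypothesis, no small boxes (Rogawski 1990 Prop. 8.2.1 (a)(d) ⟸ 8.1.3; Langlands–Shelstad descent Thm. 2.3.A, §2.4)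

Topic `NumberTheory/Rogawski1990`; namespace `Literature.NumberTheory.Rogawski1990`.  ONE THEOREM + private bookkeeping (no definition, no instance, no notation, no named
fact, no `sorry`).  Cell `pub/hodgecm-mathlib` (D-0151), crux H413 = stmt-HodgeConjecture-24833, floor-2 line «N6nsGerm» (`Cruxes/H413/Lines/F0_P3a_N6nsGerm.lean`, stub
`stub_N6nsS1`); LEAD F0P3a-plan (g9) WORD T8-82 (B) «(R-inv) is the road of record — p08 writes `LocalTransferCentralSingularJunctionInvCM`»; seat F0P3a-p08 (g13).  The sibling ★
`LocalTransferCentralSingularJunctionCM` (p841395, F0P2-p02) is the BOX form, whose binder `hsat` is CLASS-LEVEL central saturation (not in the tree; bus 2026-09-01 05:48Z);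
this file is the `Ad(M)`-INVARIANT form agreed with A-p16 (g26) (04:54∕04:58Z): every «box» is a STABLY SATURATED neighbourhood of `ε_H` (e.g. the window `{h ∣ (χ_{h.1}, u(h))
near (χ_{a·1}, u)}`), so that saturation is TRIVIAL (`x := 1`) and ★ `finsum_mem_side_eq_mul_stableOrbitalIntegralRel` applies as is.  HONEST LABEL: HC_CM is proved only modulo
the printed citations until rung 0 closes; this theorem is hypothesis-driven on its binders (dock ★ p841366, side dichotomy ∕ exclusivity = ★ B3-alg p841605 + an `S` adapter, SEP′ =
★ p841186 + window, DESCENT on the invariant set = the measure brick B4-inv, `Δ` along the dock = the κ-eigenvector reading, the `ε′`-side = the (R2) road).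

THE MATHEMATICS (loc. cit.; the invariant bookkeeping).  `v` non-split, `Δ_v = (finExplicitCollection μ) v`, `mH` canonical; `θ : H_v ≃ₜ* Z_{G′_v}(ε)` the central dock with
`θ z = y ι(z) y⁻¹`.  Binders: `hsep′` — on a stably saturated `B₇ ∋ ε_H`, `G′_v`-conjugate `θ`-images are `H_v`-conjugate (block rigidity in the window); `hside`∕`hdisj` — near
`ε_H` every matched `γ′` is conjugate to some `θ h` with `h ~st γ_H`, or satisfies the (abstract, `γ_H`-dependent) `ε′`-side predicate `Q′`, never both (★ B3-alg: block
splitting + Witt dichotomy); `hD` — DESCENT at `ε` on a stably saturated `B ∋ ε_H` (`Φ(⟦θ h⟧, ψ; mG) = Φ(⟦h⟧, ψ_ε; mH)`, `ψ_ε ∈ C_c^∞(H_v)`); `hΔθ` — `Δ_v(γ_H, θ h) = Δ_v(ε_H, ε)`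
for `γ_H` near `ε_H` and `h ~st γ_H` (the Kottwitz sign reads the `γ₂`-eigenline, which is `y·e₂` for every `θ h`; `τ`, `D` depend on `γ_H`); `hI′` — the `Q′`-side is a local
stable orbital integral.  CONCLUSION: `∃ V ∈ 𝓝 ε_H, ∃ φ^H ∈ C_c^∞(H_v)`, `Φ^st_H(γ_H, φ^H) = Σᶠ_c Δ_v(γ_H, c)·Φ(c, φ)` for `G`-regular `γ_H ∈ V` — `stub_N6nsS1`'s body at the
explicit `T`.  PROOF = p841395's, with the box `B := B₄ ∩ B₇` now stably saturated and containing `γ_H`, so that «every `γ_H′ ~st γ_H` is conjugate into `B`» holds with the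
identity conjugator; the split `F = 1_ε F + 1_{ε′} F` is `hside` + `hdisj` (unmatched classes carry `Δ = 0`), the ε-side is ★ `finsum_mem_side_eq_mul_stableOrbitalIntegralRel`, the
`ε′`-side is `hI′`, and `Φ^st` is additive on `C_c^∞` (★ `localStableOrbitalIntegralH_add_of_isLocSmooth`).

* **`exists_nhds_stableOrbitalIntegralRel_eq_of_central_singular_inv`**.

## References
* [Rogawski1990] J. D. Rogawski, *Automorphic Representations of Unitary Groups in Three Variables*, Ann. of Math. Stud. 123 (1990): §8.2 Prop. 8.2.1 (a)(d) p. 112; §8.1 Prop. 8.1.3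
  pp. 110–111; §4.3 (4.3.1) p. 43.
* [LanglandsShelstad1990Descent] R. P. Langlands, D. Shelstad, *Descent for transfer factors*, The Grothendieck Festschrift II (1990): §2.3 Thm. 2.3.A, §2.4 (equisingular descent,
  invariant neighbourhoods).
-/

set_option autoImplicit false

noncomputable section

open Set Filter Topology MeasureTheory Polynomial
open scoped Pointwise Matrix

namespace Literature.NumberTheory.Rogawski1990

open Literature.NumberTheory.Automorphic Literature.NumberTheory.Automorphic.UnitaryGroup Literature.NumberTheory.GaloisRepresentations
open _root_.NumberField _root_.IsDedekindDomain

section CentralSingularInv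

variable (L : Type) [Field L] [NumberField L] [IsCMField L] (H' : Matrix (Fin 3) (Fin 3) L) (v : HeightOneSpectrum (𝓞 ↥(maximalRealSubfield L)))

variable [iM' : ∀ γ : (cmDatum L 3 H').Local v, MeasurableSpace ((cmDatum L 3 H').Local v ⧸ Subgroup.centralizer ({γ} : Set ((cmDatum L 3 H').Local v)))]
  [iH : ∀ a : ((cmDatum L 2 (Matrix.of fun i j : Fin 2 => if i.val + j.val + 1 = 2 then (1 : L) else 0)).Local v ×
      (cmDatum L 1 (Matrix.of fun i j : Fin 1 => if i.val + j.val + 1 = 1 then (1 : L) else 0)).Local v), MeasurableSpace (((cmDatum L 2 (Matrix.of fun i j : Fin 2 => if i.val + j.val + 1 = 2 then (1 : L) else 0)).Local v ×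
      (cmDatum L 1 (Matrix.of fun i j : Fin 1 => if i.val + j.val + 1 = 1 then (1 : L) else 0)).Local v) ⧸ Subgroup.centralizer ({a} : Set ((cmDatum L 2 (Matrix.of fun i j : Fin 2 => if i.val + j.val + 1 = 2 then (1 : L) else 0)).Local v ×
      (cmDatum L 1 (Matrix.of fun i j : Fin 1 => if i.val + j.val + 1 = 1 then (1 : L) else 0)).Local v)))]

variable [MeasurableSpace ((cmDatum L 2 (Matrix.of fun i j : Fin 2 => if i.val + j.val + 1 = 2 then (1 : L) else 0)).Local v ×
      (cmDatum L 1 (Matrix.of fun i j : Fin 1 => if i.val + j.val + 1 = 1 then (1 : L) else 0)).Local v)] [BorelSpace ((cmDatum L 2 (Matrix.of fun i j : Fin 2 => if i.val + j.val + 1 = 2 then (1 : L) else 0)).Local v ×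
      (cmDatum L 1 (Matrix.of fun i j : Fin 1 => if i.val + j.val + 1 = 1 then (1 : L) else 0)).Local v)]
  [iHB : ∀ a : ((cmDatum L 2 (Matrix.of fun i j : Fin 2 => if i.val + j.val + 1 = 2 then (1 : L) else 0)).Local v ×
      (cmDatum L 1 (Matrix.of fun i j : Fin 1 => if i.val + j.val + 1 = 1 then (1 : L) else 0)).Local v), BorelSpace (((cmDatum L 2 (Matrix.of fun i j : Fin 2 => if i.val + j.val + 1 = 2 then (1 : L) else 0)).Local v ×
      (cmDatum L 1 (Matrix.of fun i j : Fin 1 => if i.val + j.val + 1 = 1 then (1 : L) else 0)).Local v) ⧸ Subgroup.centralizer ({a} : Set ((cmDatum L 2 (Matrix.of fun i j : Fin 2 => if i.val + j.val + 1 = 2 then (1 : L) else 0)).Local v ×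
      (cmDatum L 1 (Matrix.of fun i j : Fin 1 => if i.val + j.val + 1 = 1 then (1 : L) else 0)).Local v)))]

/-- **`R_φ` IS A LOCAL STABLE ORBITAL INTEGRAL AT A CENTRAL `(G,H)`-REGULAR POINT — INVARIANT FORM (no saturation, no small boxes).**  Data (`v` non-split, explicit `Δ_v`, canonical
`mH`): the central dock `θ : H_v ≃ₜ* Z_{G′_v}(ε)` with `θ z = y·ι(z)·y⁻¹` (★ p841366); an ABSTRACT `γ_H`-dependent `ε′`-side predicate `Q′` on `G′_v`; binders `hsep′` (SEP′ on a STABLY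
SATURATED neighbourhood), `hside`∕`hdisj` (the side dichotomy and its exclusivity — ★ B3-alg p841605), `hD` (DESCENT at `ε` on a stably saturated neighbourhood), `hΔθ` (`Δ_v` is constant
along the dock on stable classes near `ε_H`), `hI′` (the `Q′`-side is a local stable orbital integral).  CONCLUSION: `stub_N6nsS1`'s body at `T := (finExplicitCollection μ) v`.
[cite: Rogawski1990, §8.2 Prop. 8.2.1 (a)(d) p. 112; §8.1 Prop. 8.1.3 pp. 110–111; §4.3 (4.3.1) p. 43] [cite: LanglandsShelstad1990Descent, Thm. 2.3.A, §2.4] -/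
theorem exists_nhds_stableOrbitalIntegralRel_eq_of_central_singular_inv
    (hH' : (H'.map (cmConjRingHom L))ᵀ = H') (hdet' : H'.det ≠ 0) (μ : HeckeCharacter L)
    (hl : ∀ (v : HeightOneSpectrum (𝓞 ↥(maximalRealSubfield L))) (a : ((cmDatum L 2 (Matrix.of fun i j : Fin 2 => if i.val + j.val + 1 = 2 then (1 : L) else 0)).Local v ×
      (cmDatum L 1 (Matrix.of fun i j : Fin 1 => if i.val + j.val + 1 = 1 then (1 : L) else 0)).Local v)) (b : (cmDatum L 3 H').Local v) (x : ((cmDatum L 2 (Matrix.of fun i j : Fin 2 => if i.val + j.val + 1 = 2 then (1 : L) else 0)).Local v ×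
      (cmDatum L 1 (Matrix.of fun i j : Fin 1 => if i.val + j.val + 1 = 1 then (1 : L) else 0)).Local v)),
      finExplicitDelta L v H' (x * a * x⁻¹) μ b = finExplicitDelta L v H' a μ b)
    (hr : ∀ (v : HeightOneSpectrum (𝓞 ↥(maximalRealSubfield L))) (a : ((cmDatum L 2 (Matrix.of fun i j : Fin 2 => if i.val + j.val + 1 = 2 then (1 : L) else 0)).Local v ×
      (cmDatum L 1 (Matrix.of fun i j : Fin 1 => if i.val + j.val + 1 = 1 then (1 : L) else 0)).Local v)) (b y : (cmDatum L 3 H').Local v),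
      finExplicitDelta L v H' a μ (y * b * y⁻¹) = finExplicitDelta L v H' a μ b)
    (νH : Measure ((cmDatum L 2 (Matrix.of fun i j : Fin 2 => if i.val + j.val + 1 = 2 then (1 : L) else 0)).Local v ×
      (cmDatum L 1 (Matrix.of fun i j : Fin 1 => if i.val + j.val + 1 = 1 then (1 : L) else 0)).Local v)) [νH.IsHaarMeasure] [νH.IsMulRightInvariant]
    {mH : OrbitalMeasureFamily ((cmDatum L 2 (Matrix.of fun i j : Fin 2 => if i.val + j.val + 1 = 2 then (1 : L) else 0)).Local v ×
      (cmDatum L 1 (Matrix.of fun i j : Fin 1 => if i.val + j.val + 1 = 1 then (1 : L) else 0)).Local v)} {mG : OrbitalMeasureFamily ((cmDatum L 3 H').Local v)}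
    (hmH : mH.IsCanonical (IsLocalGRegular L v) νH)
    -- the central point and the dock at the good class `ε`
    (εH : ((cmDatum L 2 (Matrix.of fun i j : Fin 2 => if i.val + j.val + 1 = 2 then (1 : L) else 0)).Local v ×
      (cmDatum L 1 (Matrix.of fun i j : Fin 1 => if i.val + j.val + 1 = 1 then (1 : L) else 0)).Local v)) (ε : (cmDatum L 3 H').Local v) (y : GL (Fin 3) (LocalRing L v))
    (θ : ((cmDatum L 2 (Matrix.of fun i j : Fin 2 => if i.val + j.val + 1 = 2 then (1 : L) else 0)).Local v ×
      (cmDatum L 1 (Matrix.of fun i j : Fin 1 => if i.val + j.val + 1 = 1 then (1 : L) else 0)).Local v) ≃ₜ* ↥(Subgroup.centralizer ({ε} : Set ((cmDatum L 3 H').Local v))))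
    (hθ : ∀ z : ((cmDatum L 2 (Matrix.of fun i j : Fin 2 => if i.val + j.val + 1 = 2 then (1 : L) else 0)).Local v ×
      (cmDatum L 1 (Matrix.of fun i j : Fin 1 => if i.val + j.val + 1 = 1 then (1 : L) else 0)).Local v), (((θ z).1).val : GL (Fin 3) (LocalRing L v)) = y * ((endoEmbLocal L v z).val : GL (Fin 3) (LocalRing L v)) * y⁻¹)
    -- the `ε′`-side predicate (abstract; in the application: «unitarily conjugate into the frame of `ε′` with second block `γ₂`»)
    (Q' : ((cmDatum L 2 (Matrix.of fun i j : Fin 2 => if i.val + j.val + 1 = 2 then (1 : L) else 0)).Local v ×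
      (cmDatum L 1 (Matrix.of fun i j : Fin 1 => if i.val + j.val + 1 = 1 then (1 : L) else 0)).Local v) → (cmDatum L 3 H').Local v → Prop)
    -- (SEP′) on a stably saturated neighbourhood
    (hsep' : ∃ B₇ ∈ 𝓝 εH, (∀ h ∈ B₇, ∀ h' : ((cmDatum L 2 (Matrix.of fun i j : Fin 2 => if i.val + j.val + 1 = 2 then (1 : L) else 0)).Local v ×
      (cmDatum L 1 (Matrix.of fun i j : Fin 1 => if i.val + j.val + 1 = 1 then (1 : L) else 0)).Local v), IsLocalStablyConjH L v h h' → h' ∈ B₇) ∧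
      ∀ h ∈ B₇, ∀ h' ∈ B₇, ∀ x : (cmDatum L 3 H').Local v, x * ((θ h : ↥(Subgroup.centralizer ({ε} : Set ((cmDatum L 3 H').Local v)))) : (cmDatum L 3 H').Local v) * x⁻¹ = ((θ h' : ↥(Subgroup.centralizer ({ε} : Set ((cmDatum L 3 H').Local v)))) : (cmDatum L 3 H').Local v) → IsConj h h')
    -- the side dichotomy near `ε_H` and its exclusivity
    (hside : ∃ V₃ ∈ 𝓝 εH, ∀ γH ∈ V₃, IsLocalGRegular L v γH → ∀ γ' : (cmDatum L 3 H').Local v, IsLocalNormPair L H' v γH γ' →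
      (∃ x : (cmDatum L 3 H').Local v, ∃ h : ((cmDatum L 2 (Matrix.of fun i j : Fin 2 => if i.val + j.val + 1 = 2 then (1 : L) else 0)).Local v ×
      (cmDatum L 1 (Matrix.of fun i j : Fin 1 => if i.val + j.val + 1 = 1 then (1 : L) else 0)).Local v), IsLocalStablyConjH L v γH h ∧ x * γ' * x⁻¹ = ((θ h : ↥(Subgroup.centralizer ({ε} : Set ((cmDatum L 3 H').Local v)))) : (cmDatum L 3 H').Local v)) ∨ (∃ x : (cmDatum L 3 H').Local v, Q' γH (x * γ' * x⁻¹)))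
    (hdisj : ∃ V₀ ∈ 𝓝 εH, ∀ γH ∈ V₀, IsLocalGRegular L v γH → ∀ γ' : (cmDatum L 3 H').Local v,
      (∃ x : (cmDatum L 3 H').Local v, ∃ h : ((cmDatum L 2 (Matrix.of fun i j : Fin 2 => if i.val + j.val + 1 = 2 then (1 : L) else 0)).Local v ×
      (cmDatum L 1 (Matrix.of fun i j : Fin 1 => if i.val + j.val + 1 = 1 then (1 : L) else 0)).Local v), IsLocalStablyConjH L v γH h ∧ x * γ' * x⁻¹ = ((θ h : ↥(Subgroup.centralizer ({ε} : Set ((cmDatum L 3 H').Local v)))) : (cmDatum L 3 H').Local v)) → (∃ x : (cmDatum L 3 H').Local v, Q' γH (x * γ' * x⁻¹)) → False)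
    -- DESCENT at `ε` on a stably saturated neighbourhood, read on `H_v` through `θ`
    (hD : ∀ ψ : (cmDatum L 3 H').Local v → ℂ, IsLocSmooth ψ → ∃ B ∈ 𝓝 εH, (∀ h ∈ B, ∀ h' : ((cmDatum L 2 (Matrix.of fun i j : Fin 2 => if i.val + j.val + 1 = 2 then (1 : L) else 0)).Local v ×
      (cmDatum L 1 (Matrix.of fun i j : Fin 1 => if i.val + j.val + 1 = 1 then (1 : L) else 0)).Local v), IsLocalStablyConjH L v h h' → h' ∈ B) ∧
      ∃ ψε : ((cmDatum L 2 (Matrix.of fun i j : Fin 2 => if i.val + j.val + 1 = 2 then (1 : L) else 0)).Local v ×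
      (cmDatum L 1 (Matrix.of fun i j : Fin 1 => if i.val + j.val + 1 = 1 then (1 : L) else 0)).Local v) → ℂ, IsLocSmooth ψε ∧
      ∀ h ∈ B, IsLocalGRegular L v h → classOrbitalIntegral mG ψ (ConjClasses.mk ((θ h : ↥(Subgroup.centralizer ({ε} : Set ((cmDatum L 3 H').Local v)))) : (cmDatum L 3 H').Local v)) = classOrbitalIntegral mH ψε (ConjClasses.mk h))
    -- `Δ_v` along the dock on stable classes near `ε_H`
    (hΔθ : ∃ VΔ ∈ 𝓝 εH, ∀ γH ∈ VΔ, IsLocalGRegular L v γH → ∀ h : ((cmDatum L 2 (Matrix.of fun i j : Fin 2 => if i.val + j.val + 1 = 2 then (1 : L) else 0)).Local v ×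
      (cmDatum L 1 (Matrix.of fun i j : Fin 1 => if i.val + j.val + 1 = 1 then (1 : L) else 0)).Local v), IsLocalStablyConjH L v γH h →
      finExplicitDelta L v H' γH μ ((θ h : ↥(Subgroup.centralizer ({ε} : Set ((cmDatum L 3 H').Local v)))) : (cmDatum L 3 H').Local v) = finExplicitDelta L v H' εH μ ε)
    -- the `Q′`-side is a local stable orbital integral
    (hI' : ∀ ψ : (cmDatum L 3 H').Local v → ℂ, IsLocSmooth ψ → ∃ V₆ ∈ 𝓝 εH, ∃ ψ' : ((cmDatum L 2 (Matrix.of fun i j : Fin 2 => if i.val + j.val + 1 = 2 then (1 : L) else 0)).Local v ×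
      (cmDatum L 1 (Matrix.of fun i j : Fin 1 => if i.val + j.val + 1 = 1 then (1 : L) else 0)).Local v) → ℂ, IsLocSmooth ψ' ∧ ∀ γH ∈ V₆, IsLocalGRegular L v γH →
      (∑ᶠ c ∈ {c : ConjClasses ((cmDatum L 3 H').Local v) | ∃ x : (cmDatum L 3 H').Local v, Q' γH (x * Quotient.out c * x⁻¹)},
          ((finExplicitCollection L H' μ hl hr) v).Δ γH (Quotient.out c) * classOrbitalIntegral mG ψ c) =
        stableOrbitalIntegralRel (IsLocalStablyConjH L v) mH ψ' γH)
    (φ : (cmDatum L 3 H').Local v → ℂ) (hφ : IsLocSmooth φ) :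
    ∃ V ∈ 𝓝 εH, ∃ φH : ((cmDatum L 2 (Matrix.of fun i j : Fin 2 => if i.val + j.val + 1 = 2 then (1 : L) else 0)).Local v ×
      (cmDatum L 1 (Matrix.of fun i j : Fin 1 => if i.val + j.val + 1 = 1 then (1 : L) else 0)).Local v) → ℂ, IsLocSmooth φH ∧ ∀ γH ∈ V, IsLocalGRegular L v γH →
      stableOrbitalIntegralRel (IsLocalStablyConjH L v) mH φH γH =
        ∑ᶠ c : ConjClasses ((cmDatum L 3 H').Local v), ((finExplicitCollection L H' μ hl hr) v).Δ γH (Quotient.out c) * classOrbitalIntegral mG φ c := by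
  classical
  have hΔT : ∀ (a' : ((cmDatum L 2 (Matrix.of fun i j : Fin 2 => if i.val + j.val + 1 = 2 then (1 : L) else 0)).Local v ×
      (cmDatum L 1 (Matrix.of fun i j : Fin 1 => if i.val + j.val + 1 = 1 then (1 : L) else 0)).Local v)) (b : (cmDatum L 3 H').Local v), ((finExplicitCollection L H' μ hl hr) v).Δ a' b = finExplicitDelta L v H' a' μ b :=
    fun a' b => finExplicitCollection_Δ L H' μ hl hr v a' b
  -- matching along the dock
  have hθm : ∀ h : ((cmDatum L 2 (Matrix.of fun i j : Fin 2 => if i.val + j.val + 1 = 2 then (1 : L) else 0)).Local v ×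
      (cmDatum L 1 (Matrix.of fun i j : Fin 1 => if i.val + j.val + 1 = 1 then (1 : L) else 0)).Local v), IsLocalNormPair L H' v h ((θ h : ↥(Subgroup.centralizer ({ε} : Set ((cmDatum L 3 H').Local v)))) : (cmDatum L 3 H').Local v) := fun h => isConj_iff.2 ⟨y, (hθ h).symm⟩
  -- descent, separation, exclusivity, sides, `Δ`, the `ε′`-side
  obtain ⟨B₄, hB₄, hB₄sat, φε, hφε, hdesc⟩ := hD φ hφ
  obtain ⟨B₇, hB₇, hB₇sat, hsep⟩ := hsep'
  obtain ⟨V₃, hV₃, hsd⟩ := hside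
  obtain ⟨V₀, hV₀, hdj⟩ := hdisj
  obtain ⟨VΔ, hVΔ, hΔ⟩ := hΔθ
  obtain ⟨V₆, hV₆, ψ', hψ', hI⟩ := hI' φ hφ
  -- the stably saturated «box» `B := B₄ ∩ B₇`
  set B : Set ((cmDatum L 2 (Matrix.of fun i j : Fin 2 => if i.val + j.val + 1 = 2 then (1 : L) else 0)).Local v ×
      (cmDatum L 1 (Matrix.of fun i j : Fin 1 => if i.val + j.val + 1 = 1 then (1 : L) else 0)).Local v) := B₄ ∩ B₇ with hBdef
  have hB : B ∈ 𝓝 εH := inter_mem hB₄ hB₇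
  have hBsat : ∀ h ∈ B, ∀ h' : ((cmDatum L 2 (Matrix.of fun i j : Fin 2 => if i.val + j.val + 1 = 2 then (1 : L) else 0)).Local v ×
      (cmDatum L 1 (Matrix.of fun i j : Fin 1 => if i.val + j.val + 1 = 1 then (1 : L) else 0)).Local v), IsLocalStablyConjH L v h h' → h' ∈ B :=
    fun h hh h' hst => ⟨hB₄sat h hh.1 h' hst, hB₇sat h hh.2 h' hst⟩
  -- the transfer near `ε_H`
  set Δ₀ : ℂ := finExplicitDelta L v H' εH μ ε with hΔ₀
  have hsm : IsLocSmooth (Δ₀ • φε) :=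
    (isLocSmooth_iff _).2 ⟨hφε.isLocallyConstant.comp fun z => Δ₀ * z, hφε.hasCompactSupport.mul_left⟩
  refine ⟨V₃ ∩ V₀ ∩ VΔ ∩ V₆ ∩ B, inter_mem (inter_mem (inter_mem (inter_mem hV₃ hV₀) hVΔ) hV₆) hB, Δ₀ • φε + ψ', hsm.add hψ', ?_⟩
  rintro γH ⟨⟨⟨⟨hγ₃, hγ₀⟩, hγΔ⟩, hγ₆⟩, hγB⟩ hγreg
  -- the summand and the two side predicates
  set F : ConjClasses ((cmDatum L 3 H').Local v) → ℂ := fun c =>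
    ((finExplicitCollection L H' μ hl hr) v).Δ γH (Quotient.out c) * classOrbitalIntegral mG φ c with hFdef
  set Pε : ConjClasses ((cmDatum L 3 H').Local v) → Prop := fun c =>
    ∃ x : (cmDatum L 3 H').Local v, ∃ h ∈ B, IsLocalStablyConjH L v γH h ∧ x * Quotient.out c * x⁻¹ = ((θ h : ↥(Subgroup.centralizer ({ε} : Set ((cmDatum L 3 H').Local v)))) : (cmDatum L 3 H').Local v) with hPεdef
  set Pε' : ConjClasses ((cmDatum L 3 H').Local v) → Prop := fun c => ∃ x : (cmDatum L 3 H').Local v, Q' γH (x * Quotient.out c * x⁻¹) with hPε'def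
  have hFfin : (Function.support F).Finite :=
    finite_support_delta_mul_classOrbitalIntegral_of_isLocSmooth L H' v hH' hdet' _ mG φ hφ γH hγreg
  -- (1) split `F = 1_ε F + 1_{ε′} F` (the side dichotomy + exclusivity; unmatched classes carry `Δ = 0`)
  have hsplit : ∀ c, F c = (if Pε c then F c else 0) + (if Pε' c then F c else 0) := by
    intro c
    by_cases hR : IsLocalNormPair L H' v γH (Quotient.out c)
    · rcases hsd γH hγ₃ hγreg _ hR with ⟨x, h, hst, hx⟩ | ⟨x, hx⟩
      · have hP : Pε c := ⟨x, h, hBsat γH hγB h hst, hst, hx⟩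
        have hnP : ¬ Pε' c := fun h' => hdj γH hγ₀ hγreg _ ⟨x, h, hst, hx⟩ h'
        rw [if_pos hP, if_neg hnP, add_zero]
      · have hP : Pε' c := ⟨x, hx⟩
        have hnP : ¬ Pε c := fun ⟨x', h, _, hst, hx'⟩ => hdj γH hγ₀ hγreg _ ⟨x', h, hst, hx'⟩ ⟨x, hx⟩
        rw [if_neg hnP, if_pos hP, zero_add]
    · have hF0 : F c = 0 := by
        simp only [hFdef, hΔT, finExplicitDelta_of_not_isLocalNormPair L v H' γH μ hR, zero_mul]
      simp only [hF0, ite_self, add_zero]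
  have hfin₁ : (Function.support fun c => if Pε c then F c else 0).Finite :=
    hFfin.subset fun c hc => by
      simp only [Function.mem_support, ne_eq, ite_eq_right_iff, Classical.not_imp] at hc ⊢
      exact hc.2
  have hfin₂ : (Function.support fun c => if Pε' c then F c else 0).Finite :=
    hFfin.subset fun c hc => by
      simp only [Function.mem_support, ne_eq, ite_eq_right_iff, Classical.not_imp] at hc ⊢
      exact hc.2
  have hsum : (∑ᶠ c, F c) = (∑ᶠ c, if Pε c then F c else 0) + ∑ᶠ c, if Pε' c then F c else 0 := by
    rw [← finsum_add_distrib hfin₁ hfin₂]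
    exact finsum_congr hsplit
  have hite : ∀ P : ConjClasses ((cmDatum L 3 H').Local v) → Prop, (∑ᶠ c, if P c then F c else 0) = ∑ᶠ c ∈ {c | P c}, F c := by
    intro P
    rw [finsum_mem_def]
    exact finsum_congr fun c => (Set.indicator_apply _ _ _).symm
  -- (2) the `ε′`-side is `Φ^st(γ_H, ψ′)` by (Iε′)
  have hε'side : (∑ᶠ c, if Pε' c then F c else 0) = stableOrbitalIntegralRel (IsLocalStablyConjH L v) mH ψ' γH := by
    rw [hite]; exact hI γH hγ₆ hγreg
  -- (3) the ε-side is `Δ₀ · Φ^st(γ_H, φ_ε)` (★ bookkeeping lemma of the box junction; saturation into `B` is the identity conjugator)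
  have hregB : ∀ h, IsLocalStablyConjH L v γH h → IsLocalGRegular L v h := fun h hst => isGRegular_of_isStablyConjH _ _ _ _ hst hγreg
  have hsatB : ∀ γH' : ((cmDatum L 2 (Matrix.of fun i j : Fin 2 => if i.val + j.val + 1 = 2 then (1 : L) else 0)).Local v ×
      (cmDatum L 1 (Matrix.of fun i j : Fin 1 => if i.val + j.val + 1 = 1 then (1 : L) else 0)).Local v), IsLocalStablyConjH L v γH γH' → ∃ x : ((cmDatum L 2 (Matrix.of fun i j : Fin 2 => if i.val + j.val + 1 = 2 then (1 : L) else 0)).Local v ×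
      (cmDatum L 1 (Matrix.of fun i j : Fin 1 => if i.val + j.val + 1 = 1 then (1 : L) else 0)).Local v), x * γH' * x⁻¹ ∈ B :=
    fun γH' hst => ⟨1, by rw [one_mul, inv_one, mul_one]; exact hBsat γH hγB γH' hst⟩
  have hΔB : ∀ h ∈ B, IsLocalStablyConjH L v γH h → finExplicitDelta L v H' γH μ ((θ h : ↥(Subgroup.centralizer ({ε} : Set ((cmDatum L 3 H').Local v)))) : (cmDatum L 3 H').Local v) = Δ₀ :=
    fun h _ hst => hΔ γH hγΔ hγreg h hst
  have hεside : (∑ᶠ c, if Pε c then F c else 0) = Δ₀ * stableOrbitalIntegralRel (IsLocalStablyConjH L v) mH φε γH := by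
    rw [hite]
    exact finsum_mem_side_eq_mul_stableOrbitalIntegralRel L H' v μ hl hr mH mG θ γH B φ φε Δ₀ hsatB
      (fun h hh h' hh' x hx => hsep h hh.2 h' hh'.2 x hx) hΔB
      (fun h hhB hst => hdesc h hhB.1 (hregB h hst))
  -- (4) assemble: `Φ^st(γ_H, Δ₀ • φ_ε + ψ′) = Δ₀ Φ^st(γ_H, φ_ε) + Φ^st(γ_H, ψ′)`
  rw [hsum, hεside, hε'side, ← stableOrbitalIntegralRel_smul_fun]
  exact localStableOrbitalIntegralH_add_of_isLocSmooth L v (OrbitalMeasureFamily.IsCanonical.isAdmissibleOn hmH)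
    γH hγreg _ _ hsm hψ'

end CentralSingularInv

end Literature.NumberTheory.Rogawski1990

end
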